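import Literature.MathematicalPhysics.QuantumFieldTheory.Balaban1983to89.B11SectG

/-!
# `Balaban1983to89.B11SectGGradedClass` — the GRADED block norm: the weighted supremum `loc_* y f := ⨆ᵢ w(i)·loc⁽ⁱ⁾ y f` of a family of
# `B11SectG.BlockNorm`s sharing their cut-offs and localisation — the class in which an intermediate whose Hölder EXPONENT must float
# (print: *"B₀(β) → ∞ if β → 1"*, *"B′₀(ε,β) → ∞ if either ε → 0, or β → 1"*) is produced ONCE with a scalar constant and consumed at ANY exponent

T. Bałaban, *Propagators for lattice gauge theories in a background field*, Commun. Math. Phys. **99** (1985) 389–434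
[`Balaban1985BackgroundPropagators`, "B9"]; [4] = T. Bałaban, *Propagators and renormalization transformations for lattice gauge
theories. II*, Commun. Math. Phys. **96** (1984) 223–250 [`Balaban1984PropagatorsII`]; [B11] = T. Bałaban, *The variational problem and
background fields in renormalization group method for lattice gauge theories*, Commun. Math. Phys. **102** (1985) 277–309 [`Balaban1985Variational`].

statement-level skeleton of published theorems with citation tags; proofs where landed; nothing here is a claim about the
Yang–Mills mass gap

THE PRINTED LOCI.  [B9] Theorem 3.1 p. 397 L34–36: *"a constant B₀(β) dependent on d, L and β, 0 ≦ β < 1 (B₀(β) → ∞ if β → 1)"*; (3.43) p. 398: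
*"‖ζ∇_UG′(U)λ‖_β, ‖ζG′(U)∇\*_Uλ‖_β ≦ B₀(β)(Lʲη)^{1−β}e^{−δ₀d(y,y′)}|λ|"* — from SUP input a Hölder output of every exponent `β < 1`, never `β = 1`;
(3.44)–(3.45) p. 398: *"B′₀(ε), B′₀(ε,β) … (B′₀(ε) → ∞ if ε → 0, B′₀(ε,β) → ∞ if either ε → 0, or β → 1)"* — the input of the `β`-Hölder member is read
at exponent `β + ε`.  So in every composite of Theorems 3.12–3.13 (e.g. (3.153): `Φ_β∇𝔊 ⊃ Φ_β∇G₁D_U ∘ (R D\*G₁) = Φ_β∇G₁D_U ∘ (R G′D\*)` by (3.152))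
the intermediate `λ` lives in `C^{s(β)}` with `β < s(β) < 1` CHOSEN PER β; [4] (2.51)–(2.52) p. 232: block majorants compose through cut-offs of cost κ.

WHY THIS FILE (cell `pub-ymgap`, node N06, seat dag-n06-l g21; LOCATED-U5 «the exponent of the shared Hölder intermediates», HOME
`BH13-EXPONENT-MEMO.md`).  The N06 certificate displays the rows-20–21 intermediates as SINGLE free classes `bH13` (gauge modes λ) and `bXH`
(vector fields): their producers (`Letters313DZ.rgdH`, `Letters3131H.tbH ∕ tb₂H`, `Letters313Zc.gXH`) read sup-class input — print gives exponent `< 1`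
only —, their consumers (`Letters313HZ(c).pYDH β`, `hXd β`, `pWE β`) are stated for all `β < 1` and need input exponent `> β`; no single exponent serves
both.  THE GRADED CLASS removes the conflict without touching a schema, an engine, a leaf or a binder shape: `loc_* := ⨆_s w(s)·loc^{(s)}` over the
exponents `s ∈ (0,1)` with weights `0 ≤ w ≤ 1` absorbing the producers' constants; a producer lands ONCE with a scalar constant (★★ `hasMaj_into_graded`:
a family of majorants into the members with `w(i)·K_i ≤ K`), a consumer projects to the ONE exponent it needs (★★ `hasMaj_from_graded`:
`loc^{(i)} ≤ w(i)⁻¹·loc_*`, constant `w(i)⁻¹·K` — β-dependent where print's is).  GENERIC over any index type `ι`, any carrier `F`: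
* §1 ★★ `BlockNorm.graded b i₀ w κ₀ D …` — DATA: the family `b : ι → BlockNorm g F`, a base index `i₀` (whose `cut ∕ IsLoc` every member shares:
  `hcut`, `hloc`), weights `w ≥ 0`, a common cost bound `κ₀ ≥ (b i).κ`, a pointwise domination `w i·(b i).loc y f ≤ D y f` (the `BddAbove` of the
  supremum; for Hölder families: the exponent-1 size); the seven `BlockNorm` laws PROVED (`loc_cut_le` memberwise: `w·loc⁽ⁱ⁾(ζ_y f) ≤ w·κᵢ·loc⁽ⁱ⁾ f ≤ κ₀·loc_*`);
* §2 `graded_loc ∕ _cut ∕ _isLoc ∕ _κ`, ★ `le_graded_loc`, `graded_loc_le`, `graded_loc_le_dom`;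
* §3 ★★ `hasMaj_from_graded` (OUT, one exponent), ★★ `hasMaj_into_graded` (IN, the whole family), `hasMaj_into_graded_of_le` (IN from a uniform bound).
HONEST SCOPE.  Generic finite-dimensional bookkeeping (real suprema over an index type, `Real.iSup_le ∕ le_ciSup`); nothing of [B9]∕[4]∕[B11] asserted; no
pin, no schema; COUNT-NEUTRAL; N06 NOT discharged; nothing continuum, nothing about the mass gap.  Cell `pub-ymgap` (HUMAN RULING D-0062), Track A node
N06 [B9], seat `pub-ymgap-dag-n06-l` (g21), 2026-08-28.
-/

noncomputable section

namespace Literature.MathematicalPhysics.QuantumFieldTheory.Balaban1983to89.B11SectGGradedClass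

open B11SectG (BlockNorm HasMaj)

variable {g : B6.Geometry} {F : Type} [AddCommGroup F] [Module ℝ F] {ι : Type}

/-! ## §1 The graded block norm -/

section Construction

variable (b : ι → BlockNorm g F) (i₀ : ι) (w : ι → ℝ) (κ₀ : ℝ) (D : g.Site → F → ℝ)

/-- ★★ **THE GRADED BLOCK NORM** of a family `b : ι → BlockNorm g F` with weights `w ≥ 0`: local size `loc_* y f := ⨆ᵢ w i·(b i).loc y f`, the cut-offs
and the localisation predicate of the base member `b i₀` (shared by every member: `hcut`, `hloc`), cutting cost `κ₀` (a common bound of the members'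
costs), under a pointwise domination `w i·(b i).loc y f ≤ D y f` (the supremum is then a real number attained from below).  For the rows-20–21
intermediates: `ι` = the Hölder exponents `s ∈ (0,1)`, `b s` = the exponent-`s` smooth-partition class, `w s ≤ 1` with `w s·B₀(s) ≤ const`.
[cite: Balaban1985BackgroundPropagators, Thm 3.1 p.397 («B₀(β) → ∞ if β → 1») + (3.43)–(3.45) p.398; Balaban1984PropagatorsII, (2.51)–(2.52) p.232] -/
def _root_.Literature.MathematicalPhysics.QuantumFieldTheory.Balaban1983to89.B11SectG.BlockNorm.graded (hw : ∀ i, 0 ≤ w i)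
    (hcut : ∀ i, (b i).cut = (b i₀).cut) (hκ : ∀ i, (b i).κ ≤ κ₀) (hD : ∀ i y f, w i * (b i).loc y f ≤ D y f) : BlockNorm g F where
  loc y f := ⨆ i, w i * (b i).loc y f
  cut := (b i₀).cut
  IsLoc := (b i₀).IsLoc
  κ := κ₀
  κ_nonneg := (b i₀).κ_nonneg.trans (hκ i₀)
  loc_nonneg y f := Real.iSup_nonneg fun i => mul_nonneg (hw i) ((b i).loc_nonneg y f)
  loc_zero y := by simp only [(b _).loc_zero, mul_zero, Real.iSup_const_zero]
  loc_add_le y f f' := by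
    have hB : BddAbove (Set.range fun i => w i * (b i).loc y f) := ⟨D y f, by rintro _ ⟨i, rfl⟩; exact hD i y f⟩
    have hB' : BddAbove (Set.range fun i => w i * (b i).loc y f') := ⟨D y f', by rintro _ ⟨i, rfl⟩; exact hD i y f'⟩
    have h0 : 0 ≤ ⨆ i, w i * (b i).loc y f := Real.iSup_nonneg fun i => mul_nonneg (hw i) ((b i).loc_nonneg y f)
    have h0' : 0 ≤ ⨆ i, w i * (b i).loc y f' := Real.iSup_nonneg fun i => mul_nonneg (hw i) ((b i).loc_nonneg y f')
    refine Real.iSup_le (fun i => ?_) (add_nonneg h0 h0')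
    calc w i * (b i).loc y (f + f') ≤ w i * ((b i).loc y f + (b i).loc y f') := mul_le_mul_of_nonneg_left ((b i).loc_add_le y f f') (hw i)
      _ = w i * (b i).loc y f + w i * (b i).loc y f' := mul_add _ _ _
      _ ≤ _ := add_le_add (le_ciSup hB i) (le_ciSup hB' i)
  loc_neg y f := by simp only [(b _).loc_neg]
  sum_cut := (b i₀).sum_cut
  isLoc_cut := (b i₀).isLoc_cut
  loc_cut_le y f := by
    have hB : BddAbove (Set.range fun i => w i * (b i).loc y f) := ⟨D y f, by rintro _ ⟨i, rfl⟩; exact hD i y f⟩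
    have h0 : 0 ≤ ⨆ i, w i * (b i).loc y f := Real.iSup_nonneg fun i => mul_nonneg (hw i) ((b i).loc_nonneg y f)
    have hκ₀ : 0 ≤ κ₀ := (b i₀).κ_nonneg.trans (hκ i₀)
    refine Real.iSup_le (fun i => ?_) (mul_nonneg hκ₀ h0)
    have h1 : (b i).loc y ((b i₀).cut y f) ≤ κ₀ * (b i).loc y f := by
      rw [← hcut i]
      exact ((b i).loc_cut_le y f).trans (mul_le_mul_of_nonneg_right (hκ i) ((b i).loc_nonneg y f))
    calc w i * (b i).loc y ((b i₀).cut y f) ≤ w i * (κ₀ * (b i).loc y f) := mul_le_mul_of_nonneg_left h1 (hw i)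
      _ = κ₀ * (w i * (b i).loc y f) := by ring
      _ ≤ κ₀ * ⨆ i, w i * (b i).loc y f := mul_le_mul_of_nonneg_left (le_ciSup hB i) hκ₀

end Construction

/-! ## §2 Reading the construction -/

variable {b : ι → BlockNorm g F} {i₀ : ι} {w : ι → ℝ} {κ₀ : ℝ} {D : g.Site → F → ℝ}
variable {hw : ∀ i, 0 ≤ w i} {hcut : ∀ i, (b i).cut = (b i₀).cut} {hκ : ∀ i, (b i).κ ≤ κ₀} {hD : ∀ i y f, w i * (b i).loc y f ≤ D y f}

/-- the local size is the weighted supremum over the family. [cite: Balaban1985BackgroundPropagators, (3.43) p.398, bookkeeping] -/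
theorem graded_loc (y : g.Site) (f : F) : (BlockNorm.graded b i₀ w κ₀ D hw hcut hκ hD).loc y f = ⨆ i, w i * (b i).loc y f := rfl

/-- the cut-offs are the base member's (= every member's). [cite: Balaban1984PropagatorsII, (2.52) p.232, bookkeeping] -/
theorem graded_cut : (BlockNorm.graded b i₀ w κ₀ D hw hcut hκ hD).cut = (b i₀).cut := rfl

/-- localisation is the base member's. [cite: Balaban1984PropagatorsII, (2.51) p.232, bookkeeping] -/
theorem graded_isLoc (y : g.Site) (f : F) : (BlockNorm.graded b i₀ w κ₀ D hw hcut hκ hD).IsLoc y f ↔ (b i₀).IsLoc y f := Iff.rfl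

/-- the cutting cost is the common bound `κ₀` — member-uniform as soon as `κ₀` is. [cite: Balaban1984PropagatorsII, (2.52) p.232, bookkeeping] -/
theorem graded_κ : (BlockNorm.graded b i₀ w κ₀ D hw hcut hκ hD).κ = κ₀ := rfl

/-- ★ each weighted member size is below the graded size: `w i·loc⁽ⁱ⁾ y f ≤ loc_* y f`. [cite: Balaban1985BackgroundPropagators, (3.43) p.398, bookkeeping] -/
theorem le_graded_loc (i : ι) (y : g.Site) (f : F) : w i * (b i).loc y f ≤ (BlockNorm.graded b i₀ w κ₀ D hw hcut hκ hD).loc y f :=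
  le_ciSup (f := fun i => w i * (b i).loc y f) ⟨D y f, by rintro _ ⟨j, rfl⟩; exact hD j y f⟩ i

/-- the graded size is below any common bound `M ≥ 0` of the weighted member sizes. [cite: Balaban1985BackgroundPropagators, (3.43) p.398, bookkeeping] -/
theorem graded_loc_le {y : g.Site} {f : F} {M : ℝ} (hM : 0 ≤ M) (h : ∀ i, w i * (b i).loc y f ≤ M) :
    (BlockNorm.graded b i₀ w κ₀ D hw hcut hκ hD).loc y f ≤ M :=
  Real.iSup_le h hM

/-- the graded size is below the domination `D` wherever `D ≥ 0`. [cite: Balaban1985BackgroundPropagators, (3.40) p.397, bookkeeping] -/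
theorem graded_loc_le_dom {y : g.Site} {f : F} (hD0 : 0 ≤ D y f) : (BlockNorm.graded b i₀ w κ₀ D hw hcut hκ hD).loc y f ≤ D y f :=
  Real.iSup_le (fun i => hD i y f) hD0

/-- a member size is controlled by the graded size at an index of POSITIVE weight: `loc⁽ⁱ⁾ y f ≤ (w i)⁻¹·loc_* y f`.
[cite: Balaban1985BackgroundPropagators, (3.45) p.398 («B′₀(ε,β)»), bookkeeping] -/
theorem member_loc_le (i : ι) (hi : 0 < w i) (y : g.Site) (f : F) :
    (b i).loc y f ≤ (w i)⁻¹ * (BlockNorm.graded b i₀ w κ₀ D hw hcut hκ hD).loc y f := by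
  rw [le_inv_mul_iff₀ hi]
  exact le_graded_loc i y f

/-! ## §3 Majorants out of and into the graded class -/

variable {F₁ F₂ : Type} [AddCommGroup F₁] [Module ℝ F₁] [AddCommGroup F₂] [Module ℝ F₂]

/-- ★★ **OUT OF THE GRADED CLASS AT ONE INDEX** (the consumer's projection): a majorant `K` of `T` out of the member `b i` (positive weight, its localisation
implied by the base member's) is a majorant `(w i)⁻¹·K` of `T` out of the graded class — the β-member of a composite reads the intermediate at the one
exponent `s(β)` it needs, with print's β-dependent constant. [cite: Balaban1985BackgroundPropagators, (3.44)–(3.45) p.398; Balaban1984PropagatorsII, (2.51) p.232] -/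
theorem hasMaj_from_graded {b₂ : BlockNorm g F₂} {T : F →ₗ[ℝ] F₂} {K : g.Site → g.Site → ℝ} (i : ι) (hi : 0 < w i)
    (hloc : ∀ y f, (b i₀).IsLoc y f → (b i).IsLoc y f) (hK : ∀ a c, 0 ≤ K a c) (h : HasMaj (b i) b₂ T K) :
    HasMaj (BlockNorm.graded b i₀ w κ₀ D hw hcut hκ hD) b₂ T (fun y y' => (w i)⁻¹ * K y y') := by
  intro y' μ hμ y
  have h1 := h y' μ (hloc y' μ hμ) y
  calc b₂.loc y (T μ) ≤ K y y' * (b i).loc y' μ := h1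
    _ ≤ K y y' * ((w i)⁻¹ * (BlockNorm.graded b i₀ w κ₀ D hw hcut hκ hD).loc y' μ) :=
        mul_le_mul_of_nonneg_left (member_loc_le i hi y' μ) (hK y y')
    _ = (w i)⁻¹ * K y y' * (BlockNorm.graded b i₀ w κ₀ D hw hcut hκ hD).loc y' μ := by ring

/-- ★★ **INTO THE GRADED CLASS FROM THE WHOLE FAMILY** (the producer lands once): majorants `K i` of `T` into every member with `w i·K i ≤ K` give the
majorant `K` of `T` into the graded class — a sup-input producer whose exponent-`s` constant `B(s)` blows up as `s → 1` lands with the scalar constant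
`sup_s w(s)·B(s)`. [cite: Balaban1985BackgroundPropagators, Thm 3.1 p.397 («B₀(β) → ∞ if β → 1») + (3.43) p.398; Balaban1984PropagatorsII, (2.51) p.232] -/
theorem hasMaj_into_graded {b₁ : BlockNorm g F₁} {T : F₁ →ₗ[ℝ] F} {K : ι → g.Site → g.Site → ℝ} {K₀ : g.Site → g.Site → ℝ}
    (hK₀ : ∀ a c, 0 ≤ K₀ a c) (hKle : ∀ i a c, w i * K i a c ≤ K₀ a c) (h : ∀ i, HasMaj b₁ (b i) T (K i)) :
    HasMaj b₁ (BlockNorm.graded b i₀ w κ₀ D hw hcut hκ hD) T K₀ := by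
  intro y' μ hμ y
  have hl : 0 ≤ b₁.loc y' μ := b₁.loc_nonneg y' μ
  refine graded_loc_le (mul_nonneg (hK₀ y y') hl) fun i => ?_
  calc w i * (b i).loc y (T μ) ≤ w i * (K i y y' * b₁.loc y' μ) := mul_le_mul_of_nonneg_left (h i y' μ hμ y) (hw i)
    _ = (w i * K i y y') * b₁.loc y' μ := by ring
    _ ≤ K₀ y y' * b₁.loc y' μ := mul_le_mul_of_nonneg_right (hKle i y y') hl

/-- INTO the graded class from a UNIFORM family bound: if every member carries the same majorant `K ≥ 0` and `w ≤ 1`, so does the graded class.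
[cite: Balaban1984PropagatorsII, (2.51) p.232, bookkeeping] -/
theorem hasMaj_into_graded_of_le {b₁ : BlockNorm g F₁} {T : F₁ →ₗ[ℝ] F} {K : g.Site → g.Site → ℝ}
    (hK : ∀ a c, 0 ≤ K a c) (hw1 : ∀ i, w i ≤ 1) (h : ∀ i, HasMaj b₁ (b i) T K) :
    HasMaj b₁ (BlockNorm.graded b i₀ w κ₀ D hw hcut hκ hD) T K :=
  hasMaj_into_graded (K := fun _ => K) hK (fun i a c => (mul_le_of_le_one_left (hK a c) (hw1 i))) h

end Literature.MathematicalPhysics.QuantumFieldTheory.Balaban1983to89.B11SectGGradedClass
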